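import Mathlib

/-!
# Crux `ExactCertificate` (stmt-AtomisticToContinuum-11959), line `closure-makes-nogap-exact`,
# Transfer skeleton VII (`OneCrossingChainCrystallizes`): stub `stub_exists_isMinOn_of_limits`

Support file for the crux `ThreeConeCertificate.ExactCertificate`, d = 1 transfer skeleton VII
(`Cruxes.ExactCertificate.Transfer1D.OneCrossingChainCrystallizes`).  Skeleton VII shows that the
chain energy `e(b) = Σ_k V((k+1) b)` of a one-crossing pair potential attains its minimum over
`(0, ∞)` (the zero-pressure spacing).  This file proves the generic ATTAINMENT step used there:
a function `e : ℝ → ℝ` that is continuous on `(0, ∞)`, tends to `+∞` at `0⁺`, tends to `0` at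
`+∞`, and takes a negative value `e a₁ < 0` at some `a₁ > 0`, attains its minimum over `(0, ∞)`
at some `a > 0`.

Proof: the strict superlevel set `{b | e a₁ < e b}` is a neighbourhood of `0` within `(0, ∞)`
(so it contains some `(0, δ)` with `δ > 0`) and belongs to `atTop` (so it contains some
`[R, ∞)`); since `a₁` is not in it, `δ ≤ a₁ ≤ R`.  The continuous `e` attains a minimum on the
compact interval `[δ, R] ⊆ (0, ∞)` at some `a` (`IsCompact.exists_isMinOn`), and off `[δ, R]`
one has `e a ≤ e a₁ < e x`.  Pure Mathlib (`mem_nhdsGT_iff_exists_Ioo_subset`,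
`Filter.mem_atTop_sets`, `isCompact_Icc`); no helper lemmas, no named facts.  All `[folklore]`.
-/

noncomputable section

namespace Summit.AtomisticToContinuum.Crystallization.Theorems.ThreeConeCertificateExactCertificate.Transfer1D

open Set Filter Topology
open scoped BigOperators

/-- Generic attainment on the open half-line: if `e` is continuous on `(0, ∞)`, `e → +∞` at `0⁺`,
`e → 0` at `+∞`, and `e a₁ < 0` for some `a₁ > 0`, then `e` attains its minimum over `(0, ∞)` at
some `a > 0` (minimise over a compact `[δ, R] ∋ a₁` off which `e > e a₁`). [folklore] -/
theorem stub_exists_isMinOn_of_limits : ∀ (e : ℝ → ℝ), ContinuousOn e (Set.Ioi 0) →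
    Filter.Tendsto e (nhdsWithin 0 (Set.Ioi 0)) Filter.atTop →
    Filter.Tendsto e Filter.atTop (nhds 0) →
    (∃ a₁ : ℝ, 0 < a₁ ∧ e a₁ < 0) →
    ∃ a : ℝ, 0 < a ∧ IsMinOn e (Set.Ioi 0) a := by
  intro e hcont h0 hinf hex
  obtain ⟨a₁, ha₁, hneg⟩ := hex
  -- near `0⁺` the function exceeds `e a₁`
  have h0' : e ⁻¹' Ioi (e a₁) ∈ 𝓝[>] (0 : ℝ) := h0 (Ioi_mem_atTop (e a₁))
  obtain ⟨δ, hδ, hδsub⟩ := mem_nhdsGT_iff_exists_Ioo_subset.1 h0'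
  -- near `+∞` the function exceeds `e a₁ < 0`
  have hinf' : e ⁻¹' Ioi (e a₁) ∈ (atTop : Filter ℝ) := hinf (Ioi_mem_nhds hneg)
  obtain ⟨R, hR⟩ := mem_atTop_sets.1 hinf'
  -- hence `a₁ ∈ [δ, R] ⊆ (0, ∞)`
  have hδa₁ : δ ≤ a₁ := le_of_not_gt fun h => lt_irrefl (e a₁) (hδsub ⟨ha₁, h⟩)
  have ha₁R : a₁ ≤ R := le_of_not_gt fun h => lt_irrefl (e a₁) (hR a₁ h.le)
  have hδpos : (0 : ℝ) < δ := hδ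
  have hsub : Icc δ R ⊆ Ioi (0 : ℝ) := fun x hx => hδpos.trans_le hx.1
  -- minimise the continuous `e` over the compact `[δ, R]`
  obtain ⟨a, ha, hmin⟩ := isCompact_Icc.exists_isMinOn ⟨a₁, hδa₁, ha₁R⟩ (hcont.mono hsub)
  rw [isMinOn_iff] at hmin
  refine ⟨a, hsub ha, ?_⟩
  have haa₁ : e a ≤ e a₁ := hmin a₁ ⟨hδa₁, ha₁R⟩
  rw [isMinOn_iff]
  intro x hx
  by_cases hxδ : x < δ
  · exact (haa₁.trans_lt (hδsub ⟨hx, hxδ⟩)).le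
  by_cases hxR : R < x
  · exact (haa₁.trans_lt (hR x hxR.le)).le
  · exact hmin x ⟨le_of_not_gt hxδ, le_of_not_gt hxR⟩

end Summit.AtomisticToContinuum.Crystallization.Theorems.ThreeConeCertificateExactCertificate.Transfer1D
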